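import Literature.NumberTheory.ComplexMultiplication.TateHypEllPowerTowerOfCMPower
import Literature.AlgebraicGeometry.Motives.FaltingsTateIsogenyInvariance
import HarnessLib

/-!
# [Faltings 1983, §5 Kor. 1] for pairs of powers of a CM elliptic structure, unconditionally

Theorems only (topic `NumberTheory/ComplexMultiplication`; no definition, no named fact, no instance).
Sequel of `TateHypEllPowerTowerOfCMPower`.

The tree's row VI-1 binder is `faltings_tate_bijective A B ℓ` (the Tate map
`ℤ_ℓ ⊗ Hom_k(A, B) → Hom_{Γ_k}(T_ℓ A, T_ℓ B)` is bijective over a number field, [Fal83 §5 Kor. 1]); the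
sorry-free reduction `faltings_tate_bijective_of_tateHypEllPowerTower` (Tate 1966 §2 + Zarhin's corner)
needs Tate's hypothesis along `ℓ`-power towers for `(A ⊞ B) ⊞ (A ⊞ B)` only.  For `A = A₀ᵃ`, `B = A₀ᵇ`
powers of ONE abelian variety `A₀` with `T_ℓ A₀` free of rank one over `ℤ_ℓ ⊗ 𝓞_K` and a scalar
Frobenius generating `K`, that biproduct is isomorphic to `A₀^{2(a+b)}`
(`exists_iso_biprod_biproduct_const`, `biproduct.whiskerEquiv`), Tate's hypothesis is invariant under
isomorphism (`AbelianVariety.tateHypEllPowerTower_of_iso`) and holds for every power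
(`tateHypEllPowerTower_biproduct_of_tateRep_eq`).  Hence
**`faltings_tate_bijective (A₀ᵃ) (A₀ᵇ) ℓ`** (`faltings_tate_bijective_pow_pow_of_tateRep_eq`), in
particular for every pair of powers of a CM ELLIPTIC structure over a number field granted
[Shimura 1998, Thm. 18.6] (`faltings_tate_bijective_pow_pow_of_CM_elliptic_of_thm18_6`; discharged
Summits-side) — the case `a = b = 1` being `FaltingsTateOfCMElliptic` by another road (commutant of a
non-scalar Frobenius).  No polarisation, no height, no [Fal83] input.

§2 (appended): the whole `k`-ISOGENY CLASS of powers — `faltings_tate_bijective A B ℓ` for every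
`A` isogenous to `A₀ᵃ` and `B` isogenous to `A₀ᵇ` (`faltings_tate_bijective_of_isIsogenous_pow_…`),
by the tree's isogeny invariance of the statement
(`Literature.AlgebraicGeometry.Motives.faltings_tate_bijective_of_isIsogenous`, [Fal83 §5] «one may
replace A by an isogenous abelian variety»).

## References

* [Faltings1983Endlichkeit] G. Faltings, Invent. Math. 73 (1983), §5 Satz 4, Korollar 1.
* [Tate1966Endomorphisms] J. Tate, Invent. Math. 2 (1966), §2, pp. 136–137.
* [Shimura1998] G. Shimura, *Abelian Varieties with Complex Multiplication and Modular Functions*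
  (1998), §7.4 Props. 15, 17; §18.6 Thm. 18.6.
-/

noncomputable section

open CategoryTheory CategoryTheory.Limits
open scoped NumberField Pointwise IntermediateField

namespace Literature.AlgebraicGeometry.Motives.AbelianVariety

/-- **Tate's hypothesis along `ℓ`-power towers is invariant under isomorphism**: a tower onto `P'`
is a tower onto `P ≅ P'` with the same members. [cite: Tate1966Endomorphisms, §2 p. 136] -/
theorem tateHypEllPowerTower_of_iso {k : Type} [Field k] {P P' : AbelianVariety k} (e : P ≅ P')
    (ℓ : ℕ) (hP : P.tateHypEllPowerTower ℓ) : P'.tateHypEllPowerTower ℓ := by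
  intro hk B f h hf hh hhf hfh
  have hinv : IsIsogeny e.inv :=
    isIsogeny_of_isIsogeny_comp_of_isIsogeny_comp (g₁ := e.hom) (g₂ := e.hom)
      (by rw [Iso.inv_hom_id]; exact isIsogeny_id _) (by rw [Iso.hom_inv_id]; exact isIsogeny_id _)
  have hhom : IsIsogeny e.hom :=
    isIsogeny_of_isIsogeny_comp_of_isIsogeny_comp (g₁ := e.inv) (g₂ := e.inv)
      (by rw [Iso.hom_inv_id]; exact isIsogeny_id _) (by rw [Iso.inv_hom_id]; exact isIsogeny_id _)
  refine hP B (fun n => f n ≫ e.inv) (fun n => e.hom ≫ h n) (fun n => isIsogeny_comp (hf n) hinv)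
    (fun n => isIsogeny_comp hhom (hh n)) (fun n => ?_) (fun n => ?_)
  · rw [Category.assoc, reassoc_of% (hhf n), Preadditive.nsmul_comp, Category.id_comp,
      Preadditive.comp_nsmul, Iso.hom_inv_id]
  · rw [Category.assoc, e.inv_hom_id_assoc, hfh n]

/-- **A biproduct of two biproducts of a constant family is a biproduct over the sum of the index
types**: `(⨁_J A₀) ⊞ (⨁_K A₀) ≅ ⨁_{J ⊕ K} A₀`. [folklore] -/
private theorem exists_iso_biprod_biproduct_const {k : Type} [Field k] (A₀ : AbelianVariety k)
    (J K : Type) [Fintype J] [Fintype K] :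
    Nonempty (((⨁ fun _ : J => A₀) ⊞ (⨁ fun _ : K => A₀)) ≅ ⨁ fun _ : J ⊕ K => A₀) := by
  classical
  let c : J ⊕ K → AbelianVariety k := fun _ => A₀
  let hom : ((⨁ fun _ : J => A₀) ⊞ (⨁ fun _ : K => A₀)) ⟶ ⨁ c :=
    biprod.desc (biproduct.desc fun j => biproduct.ι c (Sum.inl j))
      (biproduct.desc fun k' => biproduct.ι c (Sum.inr k'))
  let inv : (⨁ c) ⟶ ((⨁ fun _ : J => A₀) ⊞ (⨁ fun _ : K => A₀)) :=
    biproduct.desc fun s => match s with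
      | Sum.inl j => biproduct.ι (fun _ : J => A₀) j ≫ biprod.inl
      | Sum.inr k' => biproduct.ι (fun _ : K => A₀) k' ≫ biprod.inr
  refine ⟨⟨hom, inv, ?_, ?_⟩⟩
  · apply biprod.hom_ext'
    · apply biproduct.hom_ext'
      intro j
      simp only [hom, inv, biprod.inl_desc_assoc, biproduct.ι_desc_assoc, biproduct.ι_desc,
        Category.comp_id]
    · apply biproduct.hom_ext'
      intro k'
      simp only [hom, inv, biprod.inr_desc_assoc, biproduct.ι_desc_assoc, biproduct.ι_desc,
        Category.comp_id]
  · apply biproduct.hom_ext'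
    rintro (j | k')
    · simp only [hom, inv, biproduct.ι_desc_assoc, Category.assoc, biprod.inl_desc, biproduct.ι_desc,
        Category.comp_id]
      rfl
    · simp only [hom, inv, biproduct.ι_desc_assoc, Category.assoc, biprod.inr_desc, biproduct.ι_desc,
        Category.comp_id]
      rfl

end Literature.AlgebraicGeometry.Motives.AbelianVariety

namespace Literature.NumberTheory.ComplexMultiplication

open Literature.AlgebraicGeometry.Motives Literature.AlgebraicGeometry.Motives.AbelianVariety

/-- **Tate's hypothesis for `⨁_J A₀` over any finite index type** (reindexing `Fin |J| ≃ J`,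
`biproduct.whiskerEquiv`), under the hypotheses of `tateHypEllPowerTower_biproduct_of_tateRep_eq`.
[cite: Tate1966Endomorphisms, §2 pp. 136–137] -/
theorem tateHypEllPowerTower_biproduct_fintype_of_tateRep_eq
    {k : Type} [Field k] {K : Type*} [Field K] [NumberField K]
    (A₀ : AbelianVariety k) (ι₀ : 𝓞 K →+* End A₀) (ℓ : ℕ) [Fact ℓ.Prime]
    (t₀ : A₀.tateModule ℓ) {κ : Type*} [Fintype κ] (b : Module.Basis κ ℤ (𝓞 K))
    (Bas₀ : Module.Basis κ ℤ_[ℓ] (A₀.tateModule ℓ))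
    (hBas₀ : ∀ k', Bas₀ k' = tateModuleMap ℓ (ι₀ (b k') : A₀ ⟶ A₀) t₀)
    (σ₀ : Field.absoluteGaloisGroup k) (π : 𝓞 K)
    (hσ₀ : A₀.tateRep ℓ σ₀ = tateModuleMap ℓ (ι₀ π : A₀ ⟶ A₀)) (hπ : ℚ⟮(π : K)⟯ = ⊤)
    (J : Type) [Fintype J] :
    (⨁ fun _ : J => A₀).tateHypEllPowerTower ℓ := by
  classical
  have e : (⨁ fun _ : Fin (Fintype.card J) => A₀) ≅ ⨁ fun _ : J => A₀ :=
    biproduct.whiskerEquiv (Fintype.equivFin J).symm fun _ => Iso.refl A₀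
  intro hk B f h hf hh hhf hfh
  exact tateHypEllPowerTower_of_iso e ℓ
    (tateHypEllPowerTower_biproduct_of_tateRep_eq A₀ ι₀ ℓ t₀ b Bas₀ hBas₀ σ₀ π hσ₀ hπ _)
    B f h hf hh hhf hfh

/-- **[Fal83 §5 Kor. 1] for every pair of powers `(A₀ᵃ, A₀ᵇ)`** of an abelian variety with
`T_ℓ A₀` free of rank one over `ℤ_ℓ ⊗ 𝓞_K` and one scalar Frobenius generating `K`: the Tate map
`ℤ_ℓ ⊗ Hom_k(A₀ᵃ, A₀ᵇ) → Hom_{Γ_k}(T_ℓ A₀ᵃ, T_ℓ A₀ᵇ)` is bijective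
(`faltings_tate_bijective (⨁_{Fin a} A₀) (⨁_{Fin b} A₀) ℓ`) — Tate's hypothesis for
`(A₀ᵃ ⊞ A₀ᵇ) ⊞ (A₀ᵃ ⊞ A₀ᵇ) ≅ A₀^{2(a+b)}`, then Tate's argument with Zarhin's corner
(`faltings_tate_bijective_of_tateHypEllPowerTower`).
[cite: Faltings1983Endlichkeit, §5 Satz 4 and Korollar 1] [cite: Tate1966Endomorphisms, §2 Prop. 1] -/
theorem faltings_tate_bijective_pow_pow_of_tateRep_eq
    {k : Type} [Field k] {K : Type*} [Field K] [NumberField K]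
    (A₀ : AbelianVariety k) (ι₀ : 𝓞 K →+* End A₀) (ℓ : ℕ) [Fact ℓ.Prime]
    (t₀ : A₀.tateModule ℓ) {κ : Type*} [Fintype κ] (b : Module.Basis κ ℤ (𝓞 K))
    (Bas₀ : Module.Basis κ ℤ_[ℓ] (A₀.tateModule ℓ))
    (hBas₀ : ∀ k', Bas₀ k' = tateModuleMap ℓ (ι₀ (b k') : A₀ ⟶ A₀) t₀)
    (σ₀ : Field.absoluteGaloisGroup k) (π : 𝓞 K)
    (hσ₀ : A₀.tateRep ℓ σ₀ = tateModuleMap ℓ (ι₀ π : A₀ ⟶ A₀)) (hπ : ℚ⟮(π : K)⟯ = ⊤) (a c : ℕ) :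
    faltings_tate_bijective (⨁ fun _ : Fin a => A₀) (⨁ fun _ : Fin c => A₀) ℓ := by
  classical
  set A : AbelianVariety k := ⨁ fun _ : Fin a => A₀ with hA
  set B : AbelianVariety k := ⨁ fun _ : Fin c => A₀ with hB
  obtain ⟨e₁⟩ := exists_iso_biprod_biproduct_const A₀ (Fin a) (Fin c)
  obtain ⟨e₂⟩ := exists_iso_biprod_biproduct_const A₀ (Fin a ⊕ Fin c) (Fin a ⊕ Fin c)
  have e : (⨁ fun _ : (Fin a ⊕ Fin c) ⊕ (Fin a ⊕ Fin c) => A₀) ≅ (A ⊞ B) ⊞ (A ⊞ B) :=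
    ((biprod.mapIso e₁ e₁).trans e₂).symm
  intro hk
  exact faltings_tate_bijective_of_tateHypEllPowerTower A B ℓ
    (tateHypEllPowerTower_of_iso e ℓ
      (tateHypEllPowerTower_biproduct_fintype_of_tateRep_eq A₀ ι₀ ℓ t₀ b Bas₀ hBas₀ σ₀ π hσ₀ hπ _))

/-- **[Fal83 §5 Kor. 1] for every pair of powers of a CM elliptic structure over a number field**,
granted [Shimura 1998, Thm. 18.6]: for `(A₀, ι₀)` of CM type `(K, Φ)` over `k` (`k → ℂ`; the
predicate quantifies over `[NumberField k]`) with `[K : ℚ] = 2`, all `a, b` and every prime `ℓ`,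
`faltings_tate_bijective (⨁_{Fin a} A₀) (⨁_{Fin b} A₀) ℓ` — Shimura–Taniyama Frobenius at a
degree-one place (`exists_tateRep_eq_tateModuleMap_and_adjoin_eq_top`) and
`faltings_tate_bijective_pow_pow_of_tateRep_eq`.  The case `a = b = 1` is
`faltings_tate_bijective_of_CM_elliptic_of_thm18_6` by another road.
[cite: Faltings1983Endlichkeit, §5 Korollar 1] [cite: Shimura1998, §18.6 Theorem 18.6; §7.4 Propositions 15 and 17] -/
theorem faltings_tate_bijective_pow_pow_of_CM_elliptic_of_thm18_6 (h186 : shimura1998_thm18_6) :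
    ∀ {k : Type} [Field k] [Algebra k ℂ] {K : Type} [Field K] [NumberField K]
      [NumberField.IsCMField K] (Φ : CMType K) (A₀ : AbelianVariety k) (ι₀ : 𝓞 K →+* End A₀),
      IsCMTypeRealisationOver Φ A₀ ι₀ → Module.finrank ℚ K = 2 →
      ∀ (a b ℓ : ℕ) [Fact ℓ.Prime],
        faltings_tate_bijective (⨁ fun _ : Fin a => A₀) (⨁ fun _ : Fin b => A₀) ℓ := by
  intro k _ _ K _ _ _ Φ A₀ ι₀ hA h2 a b ℓ _ hk
  obtain ⟨σ₀, π, hσ₀, hπ⟩ := exists_tateRep_eq_tateModuleMap_and_adjoin_eq_top h186 Φ A₀ ι₀ hA h2 ℓ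
  obtain ⟨t₀, Bas₀, hBas₀⟩ := hA.exists_basis_eq_tateModuleMap_apply ℓ
  exact faltings_tate_bijective_pow_pow_of_tateRep_eq A₀ ι₀ ℓ t₀ (NumberField.RingOfIntegers.basis K)
    Bas₀ hBas₀ σ₀ π hσ₀ hπ a b

/-! ## §2 The isogeny class of powers -/

/-- **[Fal83 §5 Kor. 1] on the isogeny class of powers**: under the hypotheses of
`faltings_tate_bijective_pow_pow_of_tateRep_eq`, `faltings_tate_bijective A B ℓ` for every `A`
`k`-isogenous to `A₀ᵃ` and every `B` `k`-isogenous to `A₀ᶜ` (isogeny invariance of the Tate map's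
bijectivity, `faltings_tate_bijective_of_isIsogenous`).
[cite: Faltings1983Endlichkeit, §5 Korollar 1 and §5 ¶1 («replace A by an isogenous abelian variety»)] -/
theorem faltings_tate_bijective_of_isIsogenous_pow_of_tateRep_eq
    {k : Type} [Field k] {K : Type*} [Field K] [NumberField K]
    (A₀ : AbelianVariety k) (ι₀ : 𝓞 K →+* End A₀) (ℓ : ℕ) [Fact ℓ.Prime]
    (t₀ : A₀.tateModule ℓ) {κ : Type*} [Fintype κ] (b : Module.Basis κ ℤ (𝓞 K))
    (Bas₀ : Module.Basis κ ℤ_[ℓ] (A₀.tateModule ℓ))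
    (hBas₀ : ∀ k', Bas₀ k' = tateModuleMap ℓ (ι₀ (b k') : A₀ ⟶ A₀) t₀)
    (σ₀ : Field.absoluteGaloisGroup k) (π : 𝓞 K)
    (hσ₀ : A₀.tateRep ℓ σ₀ = tateModuleMap ℓ (ι₀ π : A₀ ⟶ A₀)) (hπ : ℚ⟮(π : K)⟯ = ⊤) {a c : ℕ}
    {A B : AbelianVariety k} (hA : IsIsogenous (⨁ fun _ : Fin a => A₀) A)
    (hB : IsIsogenous (⨁ fun _ : Fin c => A₀) B) :
    faltings_tate_bijective A B ℓ :=
  faltings_tate_bijective_of_isIsogenous ℓ hA hB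
    (faltings_tate_bijective_pow_pow_of_tateRep_eq A₀ ι₀ ℓ t₀ b Bas₀ hBas₀ σ₀ π hσ₀ hπ a c)

/-- **[Fal83 §5 Kor. 1] on the isogeny class of powers of a CM elliptic structure**, granted
[Shimura 1998, Thm. 18.6]: for `(A₀, ι₀)` of CM type `(K, Φ)` over `k` (`k → ℂ`; the predicate
quantifies over `[NumberField k]`) with `[K : ℚ] = 2`, every `A` isogenous to `A₀ᵃ`, every `B`
isogenous to `A₀ᵇ` and every prime `ℓ`, `faltings_tate_bijective A B ℓ`.
[cite: Faltings1983Endlichkeit, §5 Korollar 1] [cite: Shimura1998, §18.6 Theorem 18.6; §7.4 Propositions 15 and 17] -/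
theorem faltings_tate_bijective_of_isIsogenous_pow_of_CM_elliptic_of_thm18_6
    (h186 : shimura1998_thm18_6) :
    ∀ {k : Type} [Field k] [Algebra k ℂ] {K : Type} [Field K] [NumberField K]
      [NumberField.IsCMField K] (Φ : CMType K) (A₀ : AbelianVariety k) (ι₀ : 𝓞 K →+* End A₀),
      IsCMTypeRealisationOver Φ A₀ ι₀ → Module.finrank ℚ K = 2 →
      ∀ (a b : ℕ) (A B : AbelianVariety k), IsIsogenous (⨁ fun _ : Fin a => A₀) A →
        IsIsogenous (⨁ fun _ : Fin b => A₀) B → ∀ (ℓ : ℕ) [Fact ℓ.Prime],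
        faltings_tate_bijective A B ℓ := by
  intro k _ _ K _ _ _ Φ A₀ ι₀ hA0 h2 a b A B hA hB ℓ _ hk
  obtain ⟨σ₀, π, hσ₀, hπ⟩ := exists_tateRep_eq_tateModuleMap_and_adjoin_eq_top h186 Φ A₀ ι₀ hA0 h2 ℓ
  obtain ⟨t₀, Bas₀, hBas₀⟩ := hA0.exists_basis_eq_tateModuleMap_apply ℓ
  exact faltings_tate_bijective_of_isIsogenous_pow_of_tateRep_eq A₀ ι₀ ℓ t₀
    (NumberField.RingOfIntegers.basis K) Bas₀ hBas₀ σ₀ π hσ₀ hπ hA hB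

end Literature.NumberTheory.ComplexMultiplication

end
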